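import Literature.MathematicalPhysics.KineticTheory.CollisionTubeWeightOscillation
import Literature.MathematicalPhysics.KineticTheory.CollisionTubePullbackPathwise
import Literature.MathematicalPhysics.KineticTheory.CollisionFluxUpperBound
import Literature.MathematicalPhysics.KineticTheory.HardSphereCanonicalPairBound
import HarnessLib

/-!
# The collision-cylinder pull-back at rung 0: two mark-generic reductions (continuity correction from the
# short-flight deficit; integrability of the one-time functionals along good orbits)

Topic `Literature/MathematicalPhysics/KineticTheory` (proof item; wanted by the crux line `Sketch` of
`InformationPercolationEngine.CollisionRate`, stmt-AtomisticToContinuum-13481, helper stub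
`stub_cylinderPullbackUnitRung0`; mark-generic forms of two constant-profile glue steps used for the sibling crux
`JParityClosure.EvenStressEnskog`, stmt-13079, there hard-wired to the truncated even marks).  Boltzmann's
collision-cylinder argument (CIP 1994 §2.2, App. 4.A) read on hard-sphere orbits on `𝕋³` (GST 2013 §4.1)
produces, besides the static tube functional, the CONTINUITY
CORRECTION `R_cont = continuityCorrection` and the SHORT-FLIGHT DEFICIT `R_short = shortFlightDeficit` of the
pull-back (`CollisionTubePullbackDefs`).  Under the homogeneous canonical Gibbs law `G_N` of constant profiles
(`localGibbsLaw σ a u θ`) — ASSUMED stationary under the flow (`hstat`) and equipped with the four rung-0 statics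
of the tree as hypotheses (swept tubes `htube`, Haar-versus-Lebesgue for minimal-image lifts `hlift`, tightness
of the kinetic energy per particle along the flow `hKE`, the pathwise mean-displacement bound `hMD`) — the
in-probability smallness of `((N+1)κ)⁻¹ R_cont[Ψ]` follows from that of `((N+1)κ)⁻¹ R_short[Ψ]`, SIMULTANEOUSLY
for every collision mark `Ψ` with `|Ψ| ≤ 2L` (`localGibbsLaw_continuityCorrection_rung0_of_shortFlightDeficit`):

* pathwise, on a good orbit with kinetic energy `≤ E₀(N+1)`,
  `((N+1)κ)⁻¹ R_cont ≤ ε/(N+1) · Σ_coll b_N(vᵢ, vⱼ) + 2C_χC_g · ((N+1)κ)⁻¹ R_short` (`continuityCorrection_le`,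
  `CollisionTubeWeightOscillation`), with the explicit velocity mark `b_N` built from the moduli of continuity of
  `χ` and `g` at the displacement scale `κ ε_N (1 + ‖vᵢ‖ + ‖vⱼ‖)`;
* `G_N{ε/(N+1) Σ_coll b_N ≥ η/2} ≤ 32 τ σ³ η⁻¹ ∫ ‖w − v‖ b_N dN(u,θ)^{⊗2}` by the collision-flux upper bound
  `localGibbsLaw_collisionMarkSum_ge_le` (Markov + stationarity + one-window statics, the Ruelle-type pair bound
  `posGibbs_pairEvent_le`), and the Gaussian integral tends to the small constant `C_Ψ(C_gϵ₁ + C_χϵ₂) ∫‖w − v‖`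
  as `N → ∞` by dominated convergence (`ε_N → 0`);
* the short-flight event at level `η/(2(2C_χC_g + 1))` is the antecedent fed with `g ≡ 0` (which `R_short`
  ignores).

Second item (`integrableOn_tubeStat_enskogRate_orbit_of_regular`): if at a mark `Ψ` the one-time tube functional
`A_t = tubeStat … Ψ r r 1 κ t` and the even tube functional `W_t = A_t − σ³ e_t` are jointly measurable and uniformly
bounded on `[0, τ] × Config` (the S6-type regularity of the cruxes), then `t ↦ A_t(Φ_t z)` and `t ↦ e_t(Φ_t z)` are
integrable on `[0, τ]` along every good orbit (`e = σ⁻³(A − W)`, `integrableOn_orbit_of_measurable_bounded`) — the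
input of the exact Enskog slicing `evenStat_sub_evenTubeTimeStat_eq`.

Deliberately NOT here: the statics themselves (tree theorems of the summit side), the short-flight bound, and the
regularity of the tube functionals at any specific mark.

## References

* C. Cercignani, R. Illner, M. Pulvirenti, *The Mathematical Theory of Dilute Gases* (1994), §2.2,
  App. 4.A. [CIPDiluteGases1994]
* I. Gallagher, L. Saint-Raymond, B. Texier, *From Newton to Boltzmann* (2013), Part II Ch. 4, §4.1
  (Prop. 4.1.1). [GallagherSaintRaymondTexier2013]
-/

noncomputable section

open MeasureTheory Set Filter Topology
open scoped ENNReal InnerProductSpace BigOperators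

namespace Literature.MathematicalPhysics.KineticTheory

open _root_.MeasureTheory Literature.Analysis.FluidPDE Literature.Analysis.FunctionSpaces

/-- **The continuity correction at rung 0 from the short-flight deficit, for every mark bounded by `2L`.**
Under the homogeneous Gibbs law of constant profiles, stationary under the hard-sphere flow (`hstat`), with the
swept-tube family (`htube`), the Haar-versus-Lebesgue inequality for minimal-image lifts (`hlift`), tightness of
the kinetic energy per particle along the flow (`hKE`) and the pathwise mean-displacement bound (`hMD`): if for
`κ < κ₀` and `N ≥ N₀` the event `{((N+1)κ)⁻¹ R_short[Ψ] > η}` has probability `≤ δ` for every mark `|Ψ| ≤ 2L`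
(antecedent), then so does `{((N+1)κ)⁻¹ R_cont[Ψ] > η}` (with new thresholds) — Boltzmann's collision cylinder
with a continuous weight, CIP 1994 App. 4.A. [cite: CIPDiluteGases1994, App. 4.A] -/
theorem localGibbsLaw_continuityCorrection_rung0_of_shortFlightDeficit
    (hstat : ∀ (σ a θ : ℝ) (u : V3) (N : ℕ) (Φ : HardSphereFlow (Torus.geometry (Fin 3)) (hsDiameter σ N) (N + 1))
      (t : ℝ), MeasurePreserving (Φ.flow t) (localGibbsLaw σ (fun _ => a) (fun _ => u) (fun _ => θ) N Φ)
        (localGibbsLaw σ (fun _ => a) (fun _ => u) (fun _ => θ) N Φ))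
    (htube : ∀ (ε h : ℝ), 0 < ε → 0 ≤ h → ∃ S : V3 → Set V3, MeasurableSet {q : V3 × V3 | q.1 ∈ S q.2} ∧
      (∀ u, volume (S u) ≤ ENNReal.ofReal (4 * ε ^ 2 * h * ‖u‖)) ∧
      ∀ (u r : V3) (s : ℝ), ε ≤ ‖r‖ → s ∈ Icc 0 h → ‖r + s • u‖ = ε → r ∈ S u)
    (hlift : ∀ B : Set V3, MeasurableSet B →
      volume {x : T3 | ∃ k : Fin 3 → ℤ, Torus.reprSym x + Torus.latticeVec k ∈ B} ≤ volume B)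
    (hKE : ∀ (a θ : ℝ) (u : V3), 0 < a → 0 < θ → ∃ σ₀ : ℝ, 0 < σ₀ ∧ ∀ σ : ℝ, 0 < σ → σ < σ₀ →
      ∀ Φ : (N : ℕ) → HardSphereFlow (Torus.geometry (Fin 3)) (hsDiameter σ N) (N + 1),
      ∀ δ : ℝ, 0 < δ → ∃ K : ℝ, ∃ N₀ : ℕ, ∀ N : ℕ, N₀ ≤ N → ∀ t : ℝ,
        localGibbsLaw σ (fun _ => a) (fun _ => u) (fun _ => θ) N (Φ N)
          {z | K < ((N : ℝ) + 1)⁻¹ * configEnergy ((Φ N).flow t z)} ≤ ENNReal.ofReal δ)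
    (hMD : ∀ (ε : ℝ) (n : ℕ) (Φ : HardSphereFlow (Torus.geometry (Fin 3)) ε n) (z : Config n (Fin 3) T3),
      z ∈ Φ.good → ∀ s s' : ℝ, (n : ℝ)⁻¹ * ∑ i, Torus.euclidDist ((Φ.flow s' z i).1) ((Φ.flow s z i).1) ≤
        Real.sqrt (2 * ((n : ℝ)⁻¹ * configEnergy z)) * |s' - s|) :
    (∃ η₀ : ℝ, 0 < η₀ ∧ ∀ (a θ : ℝ) (u : V3), 0 < a → 0 < θ → ∃ σ₀ : ℝ, 0 < σ₀ ∧ ∀ σ : ℝ, 0 < σ → σ < σ₀ → ∀ Φ : (N : ℕ) → HardSphereFlow (Torus.geometry (Fin 3)) (hsDiameter σ N) (N + 1), ∀ τ : ℝ, 0 < τ → ∀ χ : ℝ × UnitAddTorus (Fin 3) → ℝ, Continuous χ → ∀ g : ℝ → ℝ, Continuous g → (∀ a, η₀ ≤ a → g a = 0) → ∀ η δ : ℝ, 0 < η → 0 < δ → ∃ r₀ : ℝ, 0 < r₀ ∧ ∀ r : ℝ, 0 < r → r < r₀ → ∀ L : ℝ, 1 ≤ L → ∃ κ₀ : ℝ,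 0 < κ₀ ∧ ∀ κ : ℝ, 0 < κ → κ < κ₀ → ∃ N₀ : ℕ, ∀ N : ℕ, N₀ ≤ N → ∀ Ψ : V3 × V3 × V3 → ℝ, (∀ q, |Ψ q| ≤ 2 * L) → localGibbsLaw σ (fun _ => a) (fun _ => u) (fun _ => θ) N (Φ N) {z | η < ((N + 1 : ℝ) * κ)⁻¹ * shortFlightDeficit σ N (Φ N) τ Ψ κ z} ≤ ENNReal.ofReal δ) →
    ∃ η₀ : ℝ, 0 < η₀ ∧ ∀ (a θ : ℝ) (u : V3), 0 < a → 0 < θ → ∃ σ₀ : ℝ, 0 < σ₀ ∧ ∀ σ : ℝ, 0 < σ → σ < σ₀ → ∀ Φ : (N : ℕ) → HardSphereFlow (Torus.geometry (Fin 3)) (hsDiameter σ N) (N + 1), ∀ τ : ℝ, 0 < τ → ∀ χ : ℝ × UnitAddTorus (Fin 3) → ℝ, Continuous χ → ∀ g : ℝ → ℝ, Continuous g → (∀ a, η₀ ≤ a → g a = 0) → ∀ η δ : ℝ, 0 < η → 0 < δ → ∃ r₀ : ℝ, 0 < r₀ ∧ ∀ r : ℝ, 0 < r → r < r₀ → ∀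 L : ℝ, 1 ≤ L → ∃ κ₀ : ℝ, 0 < κ₀ ∧ ∀ κ : ℝ, 0 < κ → κ < κ₀ → ∃ N₀ : ℕ, ∀ N : ℕ, N₀ ≤ N → ∀ Ψ : V3 × V3 × V3 → ℝ, (∀ q, |Ψ q| ≤ 2 * L) → localGibbsLaw σ (fun _ => a) (fun _ => u) (fun _ => θ) N (Φ N) {z | η < ((N + 1 : ℝ) * κ)⁻¹ * continuityCorrection σ N (Φ N) τ χ g Ψ r κ z} ≤ ENNReal.ofReal δ := by
  intro hSF
  obtain ⟨η₀S, _, hSF0⟩ := hSF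
  refine ⟨1, one_pos, fun a θ u ha hθ => ?_⟩
  obtain ⟨σ₁, hσ₁, hsmall⟩ := exists_smallDensity uniformProfile one_pos
  obtain ⟨σ₂, hσ₂, hKE₂⟩ := hKE a θ u ha hθ
  obtain ⟨σ₃, hσ₃, hSF₁⟩ := hSF0 a θ u ha hθ
  refine ⟨min σ₁ (min σ₂ σ₃), lt_min hσ₁ (lt_min hσ₂ hσ₃), fun σ hσ hσlt Φ τ hτ χ hχ g hg hg1 η δ hη hδ => ?_⟩
  have hσ1 : σ < σ₁ := hσlt.trans_le (min_le_left _ _)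
  have hσ2 : σ < σ₂ := hσlt.trans_le ((min_le_right _ _).trans (min_le_left _ _))
  have hσ3 : σ < σ₃ := hσlt.trans_le ((min_le_right _ _).trans (min_le_right _ _))
  have hsm : SmallDensity uniformProfile σ := (hsmall σ hσ hσ1).1
  obtain ⟨Cχ, hCχ0, hχb⟩ := exists_abs_bound_chi hχ τ
  obtain ⟨Cg, hCg0, hgb⟩ := exists_abs_bound_of_cutoff hg hg1
  set C₂ : ℝ := 2 * Cχ * Cg + 1 with hC₂
  have hC₂0 : 0 < C₂ := by rw [hC₂]; positivity
  obtain ⟨rS, hrS, hSF₂⟩ := hSF₁ σ hσ hσ3 Φ τ hτ χ hχ (fun _ => 0) continuous_const (fun _ _ => rfl)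
    (η / (2 * C₂)) (δ / 3) (by positivity) (by positivity)
  refine ⟨1, one_pos, fun r hr _ L hL => ?_⟩
  obtain ⟨κS, hκS, hSF₃⟩ := hSF₂ (rS / 2) (by positivity) (by linarith) L hL
  refine ⟨κS, hκS, fun κ hκ hκlt => ?_⟩
  obtain ⟨NS, hNS⟩ := hSF₃ κ hκ hκlt
  obtain ⟨E₀, NK, hK⟩ := hKE₂ σ hσ hσ2 Φ (δ / 3) (by positivity)
  -- constants
  have hL0 : 0 < L := by linarith
  set CΨ : ℝ := 2 * L with hCΨ
  have hCΨ0 : 0 < CΨ := by rw [hCΨ]; linarith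
  set γ := gaussMeasure u θ with hγ
  set M₁ : ℝ≥0∞ := ∫⁻ p, ENNReal.ofReal ‖p.2 - p.1‖ ∂(γ.prod γ) with hM₁
  have hM₁ne : M₁ ≠ ∞ := lintegral_norm_sub_gauss_ne_top u θ
  set cI : ℝ := δ * η / (128 * τ * σ ^ 3) with hcI
  have hcI0 : 0 < cI := by rw [hcI]; positivity
  set bmax : ℝ := cI / (2 * (M₁.toReal + 1)) with hbmax
  have hbmax0 : 0 < bmax := by rw [hbmax]; positivity
  set ϵ₁ : ℝ := bmax / (2 * CΨ * (Cg + 1)) with hϵ₁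
  set ϵ₂ : ℝ := bmax / (2 * CΨ * (Cχ + 1)) with hϵ₂
  have hϵ₁0 : 0 < ϵ₁ := by rw [hϵ₁]; positivity
  have hϵ₂0 : 0 < ϵ₂ := by rw [hϵ₂]; positivity
  -- moduli of continuity of `χ` on `[0, τ] × 𝕋³` and of `g` on `[0, 3σ³/(πr³)]`
  obtain ⟨Δ₁, hΔ₁, hχuc⟩ : ∃ Δ₁ > 0, ∀ p ∈ Icc (0 : ℝ) τ ×ˢ (univ : Set T3), ∀ q ∈ Icc (0 : ℝ) τ ×ˢ (univ : Set T3),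
      dist p q ≤ Δ₁ → dist (χ p) (χ q) ≤ ϵ₁ :=
    Metric.uniformContinuousOn_iff_le.1
      (((isCompact_Icc (a := (0 : ℝ)) (b := τ)).prod (isCompact_univ (X := T3))).uniformContinuousOn_of_continuous
        hχ.continuousOn) ϵ₁ hϵ₁0
  obtain ⟨Δ₂, hΔ₂, hguc⟩ : ∃ Δ₂ > 0, ∀ x ∈ Icc (0 : ℝ) (σ ^ 3 * (3 / (Real.pi * r ^ 3))),
      ∀ y ∈ Icc (0 : ℝ) (σ ^ 3 * (3 / (Real.pi * r ^ 3))), dist x y ≤ Δ₂ → dist (g x) (g y) ≤ ϵ₂ :=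
    Metric.uniformContinuousOn_iff_le.1
      ((isCompact_Icc (a := (0 : ℝ)) (b := σ ^ 3 * (3 / (Real.pi * r ^ 3)))).uniformContinuousOn_of_continuous
        hg.continuousOn) ϵ₂ hϵ₂0
  -- the velocity marks `b_n`
  set bfun : ℕ → V3 × V3 → ℝ := fun n p => CΨ *
    (Cg * (if κ * hsDiameter σ n * (1 + (‖p.1‖ + ‖p.2‖)) ≤ Δ₁ then ϵ₁ else 2 * Cχ) +
      Cχ * (if σ ^ 3 * (3 / (Real.pi * r ^ 4)) * (κ * hsDiameter σ n * (Real.sqrt (2 * E₀) + (‖p.1‖ + ‖p.2‖))) ≤ Δ₂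
        then ϵ₂ else 2 * Cg)) with hbfun
  have hbm : ∀ n, Measurable (bfun n) := by
    intro n
    refine measurable_const.mul ((measurable_const.mul ?_).add (measurable_const.mul ?_))
    · exact Measurable.ite (measurableSet_le (by fun_prop) measurable_const) measurable_const measurable_const
    · exact Measurable.ite (measurableSet_le (by fun_prop) measurable_const) measurable_const measurable_const
  have hb0 : ∀ n p, 0 ≤ bfun n p := by
    intro n p
    refine mul_nonneg hCΨ0.le (add_nonneg (mul_nonneg hCg0 ?_) (mul_nonneg hCχ0 ?_)) <;>
      split_ifs <;> positivity
  set Bmax : ℝ := CΨ * (Cg * max ϵ₁ (2 * Cχ) + Cχ * max ϵ₂ (2 * Cg)) with hBmax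
  have hBmax0 : 0 ≤ Bmax := by rw [hBmax]; positivity
  have hbB : ∀ n p, bfun n p ≤ Bmax := by
    intro n p
    refine mul_le_mul_of_nonneg_left (add_le_add (mul_le_mul_of_nonneg_left ?_ hCg0)
      (mul_le_mul_of_nonneg_left ?_ hCχ0)) hCΨ0.le
    · split_ifs
      · exact le_max_left _ _
      · exact le_max_right _ _
    · split_ifs
      · exact le_max_left _ _
      · exact le_max_right _ _
  set blim : ℝ := CΨ * (Cg * ϵ₁ + Cχ * ϵ₂) with hblim
  have hblim0 : 0 ≤ blim := by rw [hblim]; positivity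
  have hblimle : blim ≤ bmax := by
    have h1 : CΨ * (Cg * ϵ₁) ≤ bmax / 2 := by
      rw [hϵ₁, show CΨ * (Cg * (bmax / (2 * CΨ * (Cg + 1)))) = bmax / 2 * (Cg / (Cg + 1)) by field_simp]
      exact mul_le_of_le_one_right (by positivity) ((div_le_one (by positivity)).2 (by linarith))
    have h2 : CΨ * (Cχ * ϵ₂) ≤ bmax / 2 := by
      rw [hϵ₂, show CΨ * (Cχ * (bmax / (2 * CΨ * (Cχ + 1)))) = bmax / 2 * (Cχ / (Cχ + 1)) by field_simp]
      exact mul_le_of_le_one_right (by positivity) ((div_le_one (by positivity)).2 (by linarith))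
    rw [hblim, mul_add]
    linarith
  -- dominated convergence in the particle number: `∫ ‖w − v‖ b_n → blim · M₁ < cI`
  have hmn : Measurable fun p : V3 × V3 => ‖p.2 - p.1‖ := by fun_prop
  have hlim : Tendsto (fun n => ∫⁻ p, ENNReal.ofReal (‖p.2 - p.1‖ * bfun n p) ∂(γ.prod γ)) atTop
      (𝓝 (∫⁻ p, ENNReal.ofReal (‖p.2 - p.1‖ * blim) ∂(γ.prod γ))) := by
    refine tendsto_lintegral_of_dominated_convergence (fun p => ENNReal.ofReal (‖p.2 - p.1‖ * Bmax))
      (fun n => (hmn.mul (hbm n)).ennreal_ofReal)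
      (fun n => Eventually.of_forall fun p => ENNReal.ofReal_le_ofReal
        (mul_le_mul_of_nonneg_left (hbB n p) (norm_nonneg _))) ?_ (Eventually.of_forall fun p => ?_)
    · have h : ∫⁻ p, ENNReal.ofReal (‖p.2 - p.1‖ * Bmax) ∂(γ.prod γ) = ENNReal.ofReal Bmax * M₁ := by
        rw [hM₁, ← lintegral_const_mul' _ _ ENNReal.ofReal_ne_top]
        refine lintegral_congr fun p => ?_
        rw [mul_comm, ENNReal.ofReal_mul hBmax0]
      rw [h]
      exact ENNReal.mul_ne_top ENNReal.ofReal_ne_top hM₁ne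
    · have hε := tendsto_hsDiameter σ
      have e1 : ∀ᶠ n in atTop, κ * hsDiameter σ n * (1 + (‖p.1‖ + ‖p.2‖)) ≤ Δ₁ := by
        have ht : Tendsto (fun n => κ * hsDiameter σ n * (1 + (‖p.1‖ + ‖p.2‖))) atTop (𝓝 0) := by
          simpa using ((hε.const_mul κ).mul_const (1 + (‖p.1‖ + ‖p.2‖)))
        exact (ht.eventually_lt_const hΔ₁).mono fun n hn => hn.le
      have e2 : ∀ᶠ n in atTop, σ ^ 3 * (3 / (Real.pi * r ^ 4)) *
          (κ * hsDiameter σ n * (Real.sqrt (2 * E₀) + (‖p.1‖ + ‖p.2‖))) ≤ Δ₂ := by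
        have ht : Tendsto (fun n => σ ^ 3 * (3 / (Real.pi * r ^ 4)) *
            (κ * hsDiameter σ n * (Real.sqrt (2 * E₀) + (‖p.1‖ + ‖p.2‖)))) atTop (𝓝 0) := by
          simpa using (((hε.const_mul κ).mul_const (Real.sqrt (2 * E₀) + (‖p.1‖ + ‖p.2‖))).const_mul
            (σ ^ 3 * (3 / (Real.pi * r ^ 4))))
        exact (ht.eventually_lt_const hΔ₂).mono fun n hn => hn.le
      refine tendsto_const_nhds.congr' ?_
      filter_upwards [e1, e2] with n h1 h2
      simp only [hbfun, hblim, if_pos h1, if_pos h2]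
  have hlimval : ∫⁻ p, ENNReal.ofReal (‖p.2 - p.1‖ * blim) ∂(γ.prod γ) < ENNReal.ofReal cI := by
    have h : ∫⁻ p, ENNReal.ofReal (‖p.2 - p.1‖ * blim) ∂(γ.prod γ) = ENNReal.ofReal blim * M₁ := by
      rw [hM₁, ← lintegral_const_mul' _ _ ENNReal.ofReal_ne_top]
      refine lintegral_congr fun p => ?_
      rw [mul_comm, ENNReal.ofReal_mul hblim0]
    rw [h, ← ENNReal.ofReal_toReal hM₁ne, ← ENNReal.ofReal_mul hblim0]
    refine (ENNReal.ofReal_lt_ofReal_iff hcI0).2 ?_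
    have hM0 : 0 ≤ M₁.toReal := ENNReal.toReal_nonneg
    calc blim * M₁.toReal ≤ bmax * M₁.toReal := mul_le_mul_of_nonneg_right hblimle hM0
      _ = cI / 2 * (M₁.toReal / (M₁.toReal + 1)) := by rw [hbmax]; field_simp
      _ ≤ cI / 2 * 1 := by
          gcongr
          exact (div_le_one (by positivity)).2 (by linarith)
      _ < cI := by linarith
  obtain ⟨N₁, hN₁⟩ := eventually_atTop.1 (hlim.eventually_lt_const hlimval)
  -- the threshold in `N`
  refine ⟨max (max N₁ NK) (max NS 1), fun N hN Ψ hΨb' => ?_⟩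
  have hNN₁ : N₁ ≤ N := (le_max_left _ _).trans ((le_max_left _ _).trans hN)
  have hNNK : NK ≤ N := (le_max_right _ _).trans ((le_max_left _ _).trans hN)
  have hNNS : NS ≤ N := (le_max_left _ _).trans ((le_max_right _ _).trans hN)
  have hN1 : 1 ≤ N := (le_max_right _ _).trans ((le_max_right _ _).trans hN)
  have hε0 : 0 < hsDiameter σ N := hsDiameter_pos hσ N
  have hΨb : ∀ q, |Ψ q| ≤ CΨ := fun q => by simpa only [hCΨ] using hΨb' q
  set Mu : ℝ := hsDiameter σ N / (N + 1 : ℝ) with hMu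
  have hMu0 : 0 < Mu := by rw [hMu]; positivity
  set y : ℝ := η / (2 * Mu) with hy
  have hy0 : 0 < y := by rw [hy]; positivity
  -- the three bounds
  have hBK := localGibbsLaw_collisionMarkSum_ge_le hsm.σ_lt_half.le ha hθ u (Φ N) (hstat σ a θ u N (Φ N))
    (fun i j hij T hT => posGibbs_pairEvent_le hsm hN1 hij hT)
    (fun h hh => htube _ h (hsDiameter_pos hσ N) hh) hlift hτ (hbm N) (hb0 N) hy0
  have hI : ∫⁻ p, ENNReal.ofReal (‖p.2 - p.1‖ * bfun N p) ∂(γ.prod γ) < ENNReal.ofReal cI := hN₁ N hNN₁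
  have hKEN := hK N hNNK 0
  have hSN := hNS N hNNS Ψ hΨb'
  have hgood0 : localGibbsLaw σ (fun _ => a) (fun _ => u) (fun _ => θ) N (Φ N) (Φ N).goodᶜ = 0 := by
    rw [localGibbsLaw_eq]
    exact localGibbsMeasure_absolutelyContinuous σ _ _ _ N (Φ N) (Φ N).measure_compl_good
  -- the inclusion of events
  have hsub : {z | η < ((N + 1 : ℝ) * κ)⁻¹ * continuityCorrection σ N (Φ N) τ χ g Ψ r κ z} ⊆
      (Φ N).goodᶜ ∪ {z | E₀ < ((N : ℝ) + 1)⁻¹ * configEnergy ((Φ N).flow 0 z)} ∪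
        {z | z ∈ (Φ N).good ∧ y ≤ ∑ᶠ s ∈ collisionTimes (Torus.geometry (Fin 3)) (hsDiameter σ N)
            (fun t => (Φ N).flow t z) ∩ Icc 0 τ,
          ∑ i : Fin (N + 1), ∑ j : Fin (N + 1),
            (if i ≠ j ∧ ‖(Torus.geometry (Fin 3)).sepVec ((Φ N).flow s z i).1 ((Φ N).flow s z j).1‖ =
                hsDiameter σ N then bfun N (((Φ N).flow s z i).2, ((Φ N).flow s z j).2) else 0)} ∪
        {z | η / (2 * C₂) < ((N + 1 : ℝ) * κ)⁻¹ * shortFlightDeficit σ N (Φ N) τ Ψ κ z} := by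
    intro z hz
    rw [mem_setOf_eq] at hz
    by_cases hgood : z ∈ (Φ N).good
    swap
    · exact Or.inl (Or.inl (Or.inl hgood))
    by_cases hEz : E₀ < ((N : ℝ) + 1)⁻¹ * configEnergy ((Φ N).flow 0 z)
    · exact Or.inl (Or.inl (Or.inr hEz))
    have hE' : ((N + 1 : ℕ) : ℝ)⁻¹ * configEnergy z ≤ E₀ := by
      rw [(Φ N).flow_zero z hgood] at hEz
      push_cast
      exact not_lt.1 hEz
    have hCC := continuityCorrection_le hgood hσ hr hκ hϵ₁0.le hϵ₂0.le hχb hgb hΨb hχuc hguc hE'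
      (fun s t => hMD _ _ (Φ N) z hgood s t) (bfun N) (fun s i j => le_of_eq rfl)
    rw [collisionPairSum_eq_finsum_ite (orbit_mem hgood)] at hCC
    -- name the collision sum of the mark and the deficit term
    obtain ⟨K, hKdef, hCC'⟩ : ∃ K : ℝ, K = (∑ᶠ s ∈ collisionTimes (Torus.geometry (Fin 3)) (hsDiameter σ N)
            (fun t => (Φ N).flow t z) ∩ Icc 0 τ,
          ∑ i : Fin (N + 1), ∑ j : Fin (N + 1),
            (if i ≠ j ∧ ‖(Torus.geometry (Fin 3)).sepVec ((Φ N).flow s z i).1 ((Φ N).flow s z j).1‖ =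
                hsDiameter σ N then bfun N (((Φ N).flow s z i).2, ((Φ N).flow s z j).2) else 0)) ∧
        continuityCorrection σ N (Φ N) τ χ g Ψ r κ z ≤
          κ * hsDiameter σ N * K + 2 * Cχ * Cg * shortFlightDeficit σ N (Φ N) τ Ψ κ z :=
      ⟨_, rfl, hCC⟩
    have hSFD0 : 0 ≤ shortFlightDeficit σ N (Φ N) τ Ψ κ z :=
      collisionPairSum_nonneg fun t i j => mul_nonneg (abs_nonneg _) (le_max_right _ _)
    obtain ⟨T, hTdef, hT0⟩ : ∃ T : ℝ, T = ((N + 1 : ℝ) * κ)⁻¹ * shortFlightDeficit σ N (Φ N) τ Ψ κ z ∧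
        0 ≤ T := ⟨_, rfl, mul_nonneg (by positivity) hSFD0⟩
    have hκne : κ ≠ 0 := hκ.ne'
    have hN0 : (N + 1 : ℝ) ≠ 0 := by positivity
    have hX : ((N + 1 : ℝ) * κ)⁻¹ * continuityCorrection σ N (Φ N) τ χ g Ψ r κ z ≤
        Mu * K + 2 * Cχ * Cg * T := by
      calc ((N + 1 : ℝ) * κ)⁻¹ * continuityCorrection σ N (Φ N) τ χ g Ψ r κ z
          ≤ ((N + 1 : ℝ) * κ)⁻¹ * (κ * hsDiameter σ N * K +
              2 * Cχ * Cg * shortFlightDeficit σ N (Φ N) τ Ψ κ z) :=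
            mul_le_mul_of_nonneg_left hCC' (by positivity)
        _ = Mu * K + 2 * Cχ * Cg * T := by
            rw [hMu, hTdef]
            field_simp
    by_cases hcase : η / 2 ≤ Mu * K
    · refine Or.inl (Or.inr ⟨hgood, ?_⟩)
      rw [hy, ← hKdef]
      exact (div_le_iff₀ (by positivity)).2 (by linarith)
    · refine Or.inr ?_
      rw [mem_setOf_eq, ← hTdef]
      have h1 : η / 2 < 2 * Cχ * Cg * T := by linarith [not_le.1 hcase]
      have h2 : 2 * Cχ * Cg * T ≤ C₂ * T := mul_le_mul_of_nonneg_right (by rw [hC₂]; linarith) hT0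
      exact (div_lt_iff₀ (by positivity)).2 (by linarith)
  -- the velocity-mark event
  have hBK' : localGibbsLaw σ (fun _ => a) (fun _ => u) (fun _ => θ) N (Φ N) {z | z ∈ (Φ N).good ∧ y ≤ ∑ᶠ s ∈ collisionTimes (Torus.geometry (Fin 3)) (hsDiameter σ N)
            (fun t => (Φ N).flow t z) ∩ Icc 0 τ,
          ∑ i : Fin (N + 1), ∑ j : Fin (N + 1),
            (if i ≠ j ∧ ‖(Torus.geometry (Fin 3)).sepVec ((Φ N).flow s z i).1 ((Φ N).flow s z j).1‖ =
                hsDiameter σ N then bfun N (((Φ N).flow s z i).2, ((Φ N).flow s z j).2) else 0)} ≤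
      ENNReal.ofReal (δ / 4) := by
    refine hBK.trans ?_
    calc (ENNReal.ofReal y)⁻¹ * (ENNReal.ofReal (16 * τ * ((N + 1 : ℕ) : ℝ) ^ 2 * hsDiameter σ N ^ 2) *
          ∫⁻ p, ENNReal.ofReal (‖p.2 - p.1‖ * bfun N p) ∂(γ.prod γ))
        ≤ (ENNReal.ofReal y)⁻¹ * (ENNReal.ofReal (16 * τ * ((N + 1 : ℕ) : ℝ) ^ 2 * hsDiameter σ N ^ 2) *
            ENNReal.ofReal cI) := by
          gcongr
      _ = ENNReal.ofReal (y⁻¹ * (16 * τ * ((N + 1 : ℕ) : ℝ) ^ 2 * hsDiameter σ N ^ 2) * cI) := by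
          rw [← ENNReal.ofReal_inv_of_pos hy0, ← ENNReal.ofReal_mul (by positivity),
            ← ENNReal.ofReal_mul (by positivity)]
          congr 1
          ring
      _ = ENNReal.ofReal (δ / 4) := by
          congr 1
          have hε3 : ((N + 1 : ℕ) : ℝ) * hsDiameter σ N ^ 3 = σ ^ 3 := succ_mul_hsDiameter_pow_three σ N
          rw [hy, hMu, hcI, ← hε3]
          push_cast
          field_simp
          ring
  -- assembly
  have step1 := measure_mono (μ := localGibbsLaw σ (fun _ => a) (fun _ => u) (fun _ => θ) N (Φ N)) hsub
  have step2 : localGibbsLaw σ (fun _ => a) (fun _ => u) (fun _ => θ) N (Φ N) ((Φ N).goodᶜ ∪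
        {z | E₀ < ((N : ℝ) + 1)⁻¹ * configEnergy ((Φ N).flow 0 z)} ∪
        {z | z ∈ (Φ N).good ∧ y ≤ ∑ᶠ s ∈ collisionTimes (Torus.geometry (Fin 3)) (hsDiameter σ N)
            (fun t => (Φ N).flow t z) ∩ Icc 0 τ,
          ∑ i : Fin (N + 1), ∑ j : Fin (N + 1),
            (if i ≠ j ∧ ‖(Torus.geometry (Fin 3)).sepVec ((Φ N).flow s z i).1 ((Φ N).flow s z j).1‖ =
                hsDiameter σ N then bfun N (((Φ N).flow s z i).2, ((Φ N).flow s z j).2) else 0)} ∪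
        {z | η / (2 * C₂) < ((N + 1 : ℝ) * κ)⁻¹ * shortFlightDeficit σ N (Φ N) τ Ψ κ z}) ≤
      localGibbsLaw σ (fun _ => a) (fun _ => u) (fun _ => θ) N (Φ N) (Φ N).goodᶜ +
        localGibbsLaw σ (fun _ => a) (fun _ => u) (fun _ => θ) N (Φ N)
          {z | E₀ < ((N : ℝ) + 1)⁻¹ * configEnergy ((Φ N).flow 0 z)} +
        localGibbsLaw σ (fun _ => a) (fun _ => u) (fun _ => θ) N (Φ N) {z | z ∈ (Φ N).good ∧ y ≤
          ∑ᶠ s ∈ collisionTimes (Torus.geometry (Fin 3)) (hsDiameter σ N)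
            (fun t => (Φ N).flow t z) ∩ Icc 0 τ,
          ∑ i : Fin (N + 1), ∑ j : Fin (N + 1),
            (if i ≠ j ∧ ‖(Torus.geometry (Fin 3)).sepVec ((Φ N).flow s z i).1 ((Φ N).flow s z j).1‖ =
                hsDiameter σ N then bfun N (((Φ N).flow s z i).2, ((Φ N).flow s z j).2) else 0)} +
        localGibbsLaw σ (fun _ => a) (fun _ => u) (fun _ => θ) N (Φ N)
          {z | η / (2 * C₂) < ((N + 1 : ℝ) * κ)⁻¹ * shortFlightDeficit σ N (Φ N) τ Ψ κ z} :=
    (measure_union_le _ _).trans (add_le_add ((measure_union_le _ _).trans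
      (add_le_add (measure_union_le _ _) le_rfl)) le_rfl)
  have step3 := add_le_add (add_le_add (add_le_add hgood0.le hKEN) hBK') hSN
  have step4 : (0 : ℝ≥0∞) + ENNReal.ofReal (δ / 3) + ENNReal.ofReal (δ / 4) + ENNReal.ofReal (δ / 3) ≤ ENNReal.ofReal δ := by
    rw [zero_add, ← ENNReal.ofReal_add (by positivity) (by positivity),
      ← ENNReal.ofReal_add (by positivity) (by positivity)]
    exact ENNReal.ofReal_le_ofReal (by linarith)
  exact step1.trans (step2.trans (step3.trans step4))

/-- **Integrability of the tube functional and of the Enskog rate along good orbits from S6-type regularity.**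
If at the mark `Ψ` the one-time tube functional `A_t = tubeStat … Ψ r r 1 κ t` and the even tube functional
`W_t = A_t − σ³ e_t = evenTubeStat … Ψ r κ t` are jointly Borel measurable in `(t, z)` and uniformly bounded on
`[0, τ] × Config`, then along the orbit of every good `z` both `t ↦ A_t(Φ_t z)` and `t ↦ e_t(Φ_t z)`
(`e = σ⁻³(A − W)`, `σ > 0`) are integrable on `[0, τ]` (the orbit is Borel in time, GST 2013 §4.1). [folklore] -/
theorem integrableOn_tubeStat_enskogRate_orbit_of_regular {σ : ℝ} {N : ℕ}
    {Φ : HardSphereFlow (Torus.geometry (Fin 3)) (hsDiameter σ N) (N + 1)} {z : Config (N + 1) (Fin 3) T3}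
    (hz : z ∈ Φ.good) {χ : ℝ × UnitAddTorus (Fin 3) → ℝ} {g : ℝ → ℝ} {Ψ : V3 × V3 × V3 → ℝ} {r κ τ BA BW : ℝ}
    (hσ : 0 < σ)
    (hA : Measurable fun p : ℝ × Config (N + 1) (Fin 3) T3 => tubeStat σ N χ g Ψ r r 1 κ p.1 p.2)
    (hBA : ∀ t ∈ Icc (0 : ℝ) τ, ∀ ζ : Config (N + 1) (Fin 3) T3, |tubeStat σ N χ g Ψ r r 1 κ t ζ| ≤ BA)
    (hW : Measurable fun p : ℝ × Config (N + 1) (Fin 3) T3 => evenTubeStat σ N χ g Ψ r κ p.1 p.2)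
    (hBW : ∀ t ∈ Icc (0 : ℝ) τ, ∀ ζ : Config (N + 1) (Fin 3) T3, |evenTubeStat σ N χ g Ψ r κ t ζ| ≤ BW) :
    IntegrableOn (fun t => tubeStat σ N χ g Ψ r r 1 κ t (Φ.flow t z)) (Icc 0 τ) ∧
      IntegrableOn (fun t => enskogRate σ N χ g Ψ r t (Φ.flow t z)) (Icc 0 τ) := by
  have hσ3 : 0 < σ ^ 3 := by positivity
  -- `e = σ⁻³ (A − W)`
  have he_eq : ∀ (t : ℝ) (ζ : Config (N + 1) (Fin 3) T3), enskogRate σ N χ g Ψ r t ζ =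
      (σ ^ 3)⁻¹ * (tubeStat σ N χ g Ψ r r 1 κ t ζ - evenTubeStat σ N χ g Ψ r κ t ζ) := by
    intro t ζ
    rw [evenTubeStat_def, sub_sub_cancel, ← mul_assoc, inv_mul_cancel₀ hσ3.ne', one_mul]
  have hE : Measurable (fun p : ℝ × Config (N + 1) (Fin 3) T3 => enskogRate σ N χ g Ψ r p.1 p.2) := by
    have : (fun p : ℝ × Config (N + 1) (Fin 3) T3 => enskogRate σ N χ g Ψ r p.1 p.2) =
        fun p => (σ ^ 3)⁻¹ * (tubeStat σ N χ g Ψ r r 1 κ p.1 p.2 - evenTubeStat σ N χ g Ψ r κ p.1 p.2) :=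
      funext fun p => he_eq p.1 p.2
    rw [this]
    exact (hA.sub hW).const_mul _
  have hBE : ∀ t ∈ Icc (0 : ℝ) τ, ∀ ζ : Config (N + 1) (Fin 3) T3,
      |enskogRate σ N χ g Ψ r t ζ| ≤ (σ ^ 3)⁻¹ * (BA + BW) := by
    intro t ht ζ
    rw [he_eq, abs_mul, abs_of_pos (inv_pos.2 hσ3)]
    exact mul_le_mul_of_nonneg_left ((abs_sub _ _).trans (add_le_add (hBA t ht ζ) (hBW t ht ζ))) (by positivity)
  exact ⟨integrableOn_orbit_of_measurable_bounded hz hA hBA, integrableOn_orbit_of_measurable_bounded hz hE hBE⟩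


end Literature.MathematicalPhysics.KineticTheory

end
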